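import Mathlib
import HarnessLib

/-!
# Shelf 1574, LINE 7 twin `lamb_budget_vorticity`: the ODE half of the stretching split
# (threshold absorption ⇒ the slice quarter law), tools for `stub_stretchingSplit`

Helper file (`--supports stmt-NavierStokesRegularity-1574 --as helper`). Pure real analysis, no Navier–Stokes
input: if `Z ≥ 0` is continuous on `[t₀,T)`, differentiable on `(t₀,T)` with
`Z′(s) ≤ a·Z(s)/(T−s) + C·(T−s)^{−3/2}`, `a < 1/2`, `C ≥ 0`, then
`Z(t) ≤ (√(T−t₀)·Z(t₀) + C/(1/2−a))/√(T−t)` on `[t₀,T)`. With the integrating factor `(T−s)^a` the function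
`h(s) = (T−s)^a Z(s) − (C/(1/2−a))(T−s)^{a−1/2}` is non-increasing; for `a ≥ 1/2` the comparison function is no
longer singular at `T` and only `Z = O((T−t)^{−a})` comes out — the precise place where the twin's threshold
`c₂ < 1/4` (`a = 2c₂`) bites.

The version from `t₀ = 0` (`sliceBound_of_absorbedGrowth`) is ns-idea-9 g3's sorry-free lemma of the Cruxes
workfile `Cruxes/EnstrophyQuarterLaw/Lines/lamb_budget_vorticity.lean` (b61a884b4856; not importable from
`Theorems/`), copied VERBATIM with credit (idea-crit-8 N35 checked it by hand); the shifted version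
`sliceBound_of_absorbedGrowth_from` (any left endpoint `t₀ < T`, by translation) is what the engine uses on the
Type-I rate window `[t₀, T)`.

HONEST FRAMING: calculus; nothing here bears on the regularity problem. No summit statement is proved.
-/

noncomputable section

-- the summit-side namespace repeats a component by design (D-0017)
set_option linter.dupNamespace false

namespace Summit.NavierStokesRegularity.NavierStokesRegularity.Theorems.EnstrophyQuarterLaw.LambBudget

open Set MeasureTheory Filter Topology
open scoped ENNReal NNReal

-- adapted (verbatim) from Cruxes/EnstrophyQuarterLaw/Lines/lamb_budget_vorticity.lean (ns-idea-9 g3)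
/-- **Threshold absorption ⇒ quarter law.** If `Z ≥ 0` is continuous on `[0,T)`, differentiable on
`(0,T)` with `Z′(s) ≤ a·Z(s)/(T−s) + C·(T−s)^{−3/2}` where `0 ≤ a < 1/2` and `0 ≤ C`, then
`Z(t) ≤ (√T·Z(0) + C/(1/2−a))/√(T−t)` on `[0,T)`. [folklore] -/
theorem sliceBound_of_absorbedGrowth {T a C : ℝ} (hT : 0 < T) (ha : a < 1 / 2) (hC : 0 ≤ C)
    {Z dZ : ℝ → ℝ} (hcont : ContinuousOn Z (Ico 0 T)) (hderiv : ∀ s ∈ Ioo 0 T, HasDerivAt Z (dZ s) s)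
    (hnn : ∀ s ∈ Ico 0 T, 0 ≤ Z s)
    (hgrowth : ∀ s ∈ Ioo 0 T, dZ s ≤ a * Z s / (T - s) + C * (T - s) ^ (-(3 : ℝ) / 2)) :
    ∀ t ∈ Ico 0 T, Z t ≤ (Real.sqrt T * Z 0 + C / (1 / 2 - a)) / Real.sqrt (T - t) := by
  intro t ht
  have hTt : 0 < T - t := sub_pos.2 ht.2
  set K₂ : ℝ := C / (1 / 2 - a) with hK₂
  have hgap : 0 < 1 / 2 - a := by linarith
  have hK₂nn : 0 ≤ K₂ := div_nonneg hC hgap.le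
  -- the comparison function
  set h : ℝ → ℝ := fun s => (T - s) ^ a * Z s - K₂ * (T - s) ^ (a - 1 / 2) with hh
  -- derivative of h on (0,T)
  have hderivh : ∀ s ∈ Ioo 0 T, HasDerivAt h
      ((-1 * a * (T - s) ^ (a - 1)) * Z s + (T - s) ^ a * dZ s
        - K₂ * (-1 * (a - 1 / 2) * (T - s) ^ (a - 1 / 2 - 1))) s := by
    intro s hs
    have hTs : 0 < T - s := sub_pos.2 hs.2
    have hb : HasDerivAt (fun x => T - x) (-1) s := by
      simpa using (hasDerivAt_id s).const_sub T
    have hp : HasDerivAt (fun x => (T - x) ^ a) (-1 * a * (T - s) ^ (a - 1)) s :=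
      hb.rpow_const (Or.inl hTs.ne')
    have hq : HasDerivAt (fun x => (T - x) ^ (a - 1 / 2)) (-1 * (a - 1 / 2) * (T - s) ^ (a - 1 / 2 - 1)) s :=
      hb.rpow_const (Or.inl hTs.ne')
    exact (hp.mul (hderiv s hs)).sub (hq.const_mul K₂)
  -- sign of the derivative
  have hderivh_nonpos : ∀ s ∈ Ioo 0 T,
      (-1 * a * (T - s) ^ (a - 1)) * Z s + (T - s) ^ a * dZ s
        - K₂ * (-1 * (a - 1 / 2) * (T - s) ^ (a - 1 / 2 - 1)) ≤ 0 := by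
    intro s hs
    have hTs : 0 < T - s := sub_pos.2 hs.2
    have hZs : 0 ≤ Z s := hnn s ⟨hs.1.le, hs.2⟩
    have hpa : 0 ≤ (T - s) ^ a := Real.rpow_nonneg hTs.le a
    have h1 : (T - s) ^ a * dZ s ≤ (T - s) ^ a * (a * Z s / (T - s) + C * (T - s) ^ (-(3 : ℝ) / 2)) :=
      mul_le_mul_of_nonneg_left (hgrowth s hs) hpa
    have e1 : (T - s) ^ a * (a * Z s / (T - s)) = a * (T - s) ^ (a - 1) * Z s := by
      rw [Real.rpow_sub_one hTs.ne']
      field_simp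
    have e2 : (T - s) ^ a * (C * (T - s) ^ (-(3 : ℝ) / 2)) = C * (T - s) ^ (a - 1 / 2 - 1) := by
      have : a - 1 / 2 - 1 = a + (-(3 : ℝ) / 2) := by ring
      rw [this, Real.rpow_add hTs]
      ring
    have e3 : K₂ * (-1 * (a - 1 / 2) * (T - s) ^ (a - 1 / 2 - 1)) = C * (T - s) ^ (a - 1 / 2 - 1) := by
      have hK₂C : K₂ * (1 / 2 - a) = C := by
        rw [hK₂]; exact div_mul_cancel₀ C hgap.ne'
      calc K₂ * (-1 * (a - 1 / 2) * (T - s) ^ (a - 1 / 2 - 1))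
            = (K₂ * (1 / 2 - a)) * (T - s) ^ (a - 1 / 2 - 1) := by ring
        _ = C * (T - s) ^ (a - 1 / 2 - 1) := by rw [hK₂C]
    rw [e3]
    have h2 : (T - s) ^ a * dZ s ≤ a * (T - s) ^ (a - 1) * Z s + C * (T - s) ^ (a - 1 / 2 - 1) := by
      calc (T - s) ^ a * dZ s ≤ (T - s) ^ a * (a * Z s / (T - s) + C * (T - s) ^ (-(3 : ℝ) / 2)) := h1
        _ = a * (T - s) ^ (a - 1) * Z s + C * (T - s) ^ (a - 1 / 2 - 1) := by rw [mul_add, e1, e2]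
    linarith [h2]
  -- h is antitone on [0, t]
  have htT : Icc 0 t ⊆ Ico 0 T := fun s hs => ⟨hs.1, hs.2.trans_lt ht.2⟩
  have hcont_h : ContinuousOn h (Icc 0 t) := by
    have hb : ContinuousOn (fun s : ℝ => T - s) (Icc 0 t) := (continuous_const.sub continuous_id).continuousOn
    have hne : ∀ s ∈ Icc 0 t, T - s ≠ 0 ∨ 0 ≤ a := fun s hs => Or.inl (sub_pos.2 (hs.2.trans_lt ht.2)).ne'
    have hne' : ∀ s ∈ Icc 0 t, T - s ≠ 0 ∨ 0 ≤ a - 1 / 2 := fun s hs =>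
      Or.inl (sub_pos.2 (hs.2.trans_lt ht.2)).ne'
    exact ((hb.rpow_const hne).mul (hcont.mono htT)).sub ((hb.rpow_const hne').const_smul K₂ |>.congr
      (fun s _ => by simp [smul_eq_mul]))
  have hanti : AntitoneOn h (Icc 0 t) := by
    apply antitoneOn_of_deriv_nonpos (convex_Icc 0 t) hcont_h
    · rw [interior_Icc]
      intro s hs
      exact (hderivh s ⟨hs.1, hs.2.trans ht.2⟩).differentiableAt.differentiableWithinAt
    · rw [interior_Icc]
      intro s hs
      rw [(hderivh s ⟨hs.1, hs.2.trans ht.2⟩).deriv]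
      exact hderivh_nonpos s ⟨hs.1, hs.2.trans ht.2⟩
  have hmain : h t ≤ h 0 := hanti (left_mem_Icc.2 ht.1) (right_mem_Icc.2 ht.1) ht.1
  -- unfold and finish with real arithmetic
  have hZ0 : 0 ≤ Z 0 := hnn 0 ⟨le_rfl, hT⟩
  have hZt : 0 ≤ Z t := hnn t ht
  simp only [hh, sub_zero] at hmain
  -- hmain : (T - t) ^ a * Z t - K₂ * (T - t) ^ (a - 1/2) ≤ T ^ a * Z 0 - K₂ * T ^ (a - 1/2)
  have hpa : 0 < (T - t) ^ a := Real.rpow_pos_of_pos hTt a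
  have hq_t : 0 < (T - t) ^ (a - 1 / 2) := Real.rpow_pos_of_pos hTt _
  have hq_T : 0 ≤ T ^ (a - 1 / 2) := Real.rpow_nonneg hT.le _
  -- T^a Z0 ≤ √T Z0 (T-t)^(a-1/2)
  have hTa : T ^ a = Real.sqrt T * T ^ (a - 1 / 2) := by
    rw [Real.sqrt_eq_rpow, ← Real.rpow_add hT]
    norm_num
  have hmono : T ^ (a - 1 / 2) ≤ (T - t) ^ (a - 1 / 2) :=
    Real.rpow_le_rpow_of_nonpos hTt (by linarith [ht.1]) (by linarith)
  have step1 : (T - t) ^ a * Z t ≤ (Real.sqrt T * Z 0 + K₂) * (T - t) ^ (a - 1 / 2) := by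
    have : T ^ a * Z 0 ≤ Real.sqrt T * Z 0 * (T - t) ^ (a - 1 / 2) := by
      rw [hTa]
      have hs0 : 0 ≤ Real.sqrt T * Z 0 := mul_nonneg (Real.sqrt_nonneg _) hZ0
      nlinarith [mul_le_mul_of_nonneg_left hmono hs0]
    nlinarith [hmain, this, mul_nonneg hK₂nn hq_T]
  -- divide by (T - t)^a and rewrite (T-t)^(a-1/2) / (T-t)^a = 1/√(T-t)
  have hsplit : (T - t) ^ (a - 1 / 2) = (T - t) ^ a * (Real.sqrt (T - t))⁻¹ := by
    rw [Real.sqrt_eq_rpow, ← Real.rpow_neg hTt.le, ← Real.rpow_add hTt]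
    norm_num
    ring_nf
  rw [hsplit] at step1
  have hsq : 0 < Real.sqrt (T - t) := Real.sqrt_pos.2 hTt
  rw [le_div_iff₀ hsq]
  have step2 : (T - t) ^ a * (Z t * Real.sqrt (T - t)) ≤ (T - t) ^ a * (Real.sqrt T * Z 0 + K₂) := by
    have := step1
    calc (T - t) ^ a * (Z t * Real.sqrt (T - t))
          = ((T - t) ^ a * Z t) * Real.sqrt (T - t) := by ring
      _ ≤ ((Real.sqrt T * Z 0 + K₂) * ((T - t) ^ a * (Real.sqrt (T - t))⁻¹)) * Real.sqrt (T - t) :=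
            mul_le_mul_of_nonneg_right this hsq.le
      _ = (T - t) ^ a * (Real.sqrt T * Z 0 + K₂) := by field_simp
  exact le_of_mul_le_mul_left step2 hpa


/-- **Threshold absorption ⇒ quarter law, from any left endpoint `t₀ < T`** (translation of
`sliceBound_of_absorbedGrowth`): if `Z ≥ 0` is continuous on `[t₀,T)`, differentiable on `(t₀,T)` with
`Z′(s) ≤ a·Z(s)/(T−s) + C·(T−s)^{−3/2}`, `a < 1/2`, `0 ≤ C`, then
`Z(t) ≤ (√(T−t₀)·Z(t₀) + C/(1/2−a))/√(T−t)` on `[t₀,T)`. [folklore] -/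
theorem sliceBound_of_absorbedGrowth_from {t₀ T a C : ℝ} (ht₀ : t₀ < T) (ha : a < 1 / 2) (hC : 0 ≤ C)
    {Z dZ : ℝ → ℝ} (hcont : ContinuousOn Z (Ico t₀ T)) (hderiv : ∀ s ∈ Ioo t₀ T, HasDerivAt Z (dZ s) s)
    (hnn : ∀ s ∈ Ico t₀ T, 0 ≤ Z s)
    (hgrowth : ∀ s ∈ Ioo t₀ T, dZ s ≤ a * Z s / (T - s) + C * (T - s) ^ (-(3 : ℝ) / 2)) :
    ∀ t ∈ Ico t₀ T, Z t ≤ (Real.sqrt (T - t₀) * Z t₀ + C / (1 / 2 - a)) / Real.sqrt (T - t) := by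
  intro t ht
  -- translate: `Z̃ s = Z (t₀ + s)` on `[0, T − t₀)`
  set T' : ℝ := T - t₀ with hT'
  have hT'pos : 0 < T' := sub_pos.2 ht₀
  set W : ℝ → ℝ := fun s => Z (t₀ + s) with hW
  set dW : ℝ → ℝ := fun s => dZ (t₀ + s) with hdW
  have hmem : ∀ {s}, s ∈ Ico 0 T' → t₀ + s ∈ Ico t₀ T := fun {s} hs =>
    ⟨by linarith [hs.1], by rw [hT'] at hs; linarith [hs.2]⟩
  have hmem' : ∀ {s}, s ∈ Ioo 0 T' → t₀ + s ∈ Ioo t₀ T := fun {s} hs =>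
    ⟨by linarith [hs.1], by rw [hT'] at hs; linarith [hs.2]⟩
  have hcontW : ContinuousOn W (Ico 0 T') := by
    refine hcont.comp (continuous_const.add continuous_id).continuousOn fun s hs => hmem hs
  have hderivW : ∀ s ∈ Ioo 0 T', HasDerivAt W (dW s) s := by
    intro s hs
    have h := hderiv (t₀ + s) (hmem' hs)
    have h2 : HasDerivAt (fun r : ℝ => t₀ + r) 1 s := by
      simpa using (hasDerivAt_id s).const_add t₀
    have := h.comp s h2
    simpa [hW, hdW, Function.comp_def] using this
  have hnnW : ∀ s ∈ Ico 0 T', 0 ≤ W s := fun s hs => hnn _ (hmem hs)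
  have hgrowthW : ∀ s ∈ Ioo 0 T', dW s ≤ a * W s / (T' - s) + C * (T' - s) ^ (-(3 : ℝ) / 2) := by
    intro s hs
    have h := hgrowth (t₀ + s) (hmem' hs)
    have e : T - (t₀ + s) = T' - s := by rw [hT']; ring
    simpa [hW, hdW, e] using h
  have hb := sliceBound_of_absorbedGrowth hT'pos ha hC hcontW hderivW hnnW hgrowthW (t - t₀)
    ⟨by linarith [ht.1], by rw [hT']; linarith [ht.2]⟩
  have e1 : t₀ + (t - t₀) = t := by ring
  have e2 : T' - (t - t₀) = T - t := by rw [hT']; ring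
  simpa [hW, e1, e2, hT'] using hb

end Summit.NavierStokesRegularity.NavierStokesRegularity.Theorems.EnstrophyQuarterLaw.LambBudget

end
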